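import Summits.Parity.GeneralizedHardyLittlewood.Theorems.TableChowla.Negative.TableChowlaEquivalentForms
import Summits.Parity.GeneralizedHardyLittlewood.Theorems.TableChowla.Negative.TableChowlaPeriodicSymbols
import Summits.Parity.GeneralizedHardyLittlewood.Theorems.LiouvilleShiftedTablesTableToDilated

/-!
# Exact identities on the shifted multiplication table and shift-multiple monotonicity (`TableChowla`, stmt-Parity-14270)

Kernel-checked versions, in the tree's vocabulary (`Negative.lam`, `Negative.rowCorr`), of the three
sorried identities of the crux sketch `Cruxes/TableChowla/SketchIdeatorR2I4.lean` (crux-ideate round 2,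
ideator 4; levers L2, L3, L9 of `Cruxes/TableChowla/IDEATE-r2-i4-unused-levers.md`):

* `rowCorr_lam_unforced` (L3, un-forced alignment): with `m = ab + c`,
  `T_c(a,a';B) = λ(a) · Σ_{b ≤ B} λ(ab+c) · λ(a'(ab+c) + c(a − a'))` — modulus `a` only;
* `rowCorr_lam_multiple` (L2, multiple identity, stated for every `d ≥ 1`, primes included):
  `T_c(a,a';B) = Σ_{b'' ≤ dB, d ∣ b''} λ(a b'' + d c) λ(a' b'' + d c)`;
* `descent_rows_divisible` (L9, row-anatomy descent): a bilinear form of the table on the rows divisible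
  by `d` is a bilinear form of the `(A/d, dB)` table against the column vector spread to multiples of `d`.

All three are elementary (complete multiplicativity `λ(mn) = λ(m)λ(n)`, `λ(n)² = 1`, reindexing
`b ↦ d b`). They conclude nothing about the crux by themselves; they are landed `--supports` so that the
negative notes citing them are exact.

CONSEQUENCE (new calibration of the crux, from L2 + block positivity
`Theorems.tableToDilated_block_fourth_moment_le`): SHIFT-MULTIPLE MONOTONICITY.
* `moment_le_moment_mul_shift`: `T_c(x, A) ≤ T_{dc}(dx, A)` for every `d ≥ 1` once `|c| + 1 ≤ A` — the
  `c`-table at `(x, A)` is the `{d ∣ column}` slice of the `dc`-table at `(dx, A)`, and block fourth moments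
  are monotone under restriction of columns;
* `tableChowlaBoundAt_of_mul_shift`: the crux's bound at shift `dc` (all parameter points `(δ, C)`) implies
  the bound at shift `c` (all `(δ, C)`): the loss factor `d²` is absorbed by `∀ C ∃ x₀` (`d² ≤ log x`) and the
  scale change `x ↔ dx` by `∀ δ` (two parameter points `δ` and `δ/2` at shift `dc` cover the window at `c`);
* `tableChowla_iff_shifts_dvd`: for every `D ≥ 1`, `TableChowla` is EQUIVALENT to its restriction to the
  shifts divisible by `D` — without loss of generality the shift is divisible by any fixed modulus; the
  single-shift statements are monotone along divisibility (`c = ±1` are the weakest instances, and a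
  counterexample at shift `c` persists at every multiple `dc`, at scale `dx`). [folklore]
-/

namespace Summit.Parity.GeneralizedHardyLittlewood.Theorems.TableChowla.SketchIdentities

open Finset Real
open Summit.Parity.GeneralizedHardyLittlewood.Theses
open Summit.Parity.GeneralizedHardyLittlewood.Theorems
open Summit.Parity.GeneralizedHardyLittlewood.Theorems.TableChowla.Negative

noncomputable section

/-- L3, the algebra behind the un-forced alignment: `a·(a'b + c) = a'·(ab + c) + c·(a − a')`. -/
theorem unforced_algebra (a a' b c : ℤ) : a * (a' * b + c) = a' * (a * b + c) + c * (a - a') := by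
  ring

/-- `Int.toNat` commutes with multiplication by a natural number on non-negative integers. -/
theorem toNat_natCast_mul {d : ℕ} {z : ℤ} (hz : 0 ≤ z) :
    Int.toNat ((d : ℤ) * z) = d * Int.toNat z := by
  obtain ⟨n, rfl⟩ := Int.eq_ofNat_of_zero_le hz
  rw [show ((d : ℤ) * (n : ℤ)) = ((d * n : ℕ) : ℤ) by push_cast; ring, Int.toNat_natCast,
    Int.toNat_natCast]

/-- `λ(d·n) = λ(d) λ(n)` through `Int.toNat`, for a non-negative integer argument. -/
theorem lam_toNat_mul {d : ℕ} {z : ℤ} (hz : 0 ≤ z) :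
    lam (Int.toNat ((d : ℤ) * z)) = lam d * lam (Int.toNat z) := by
  rw [toNat_natCast_mul hz, lam_mul]

/-- L3 (un-forced alignment, level `σ`): for `a ≥ 1` and table entries `≥ 1`,
`T_c(a,a';B) = λ(a) · Σ_{b ≤ B} λ(ab+c) · λ(a'(ab+c) + c(a−a'))`; with `m = ab + c ≡ c (mod a)` the second
factor is `λ(a' m + c(a−a'))` — modulus `a` only, dilation `a'`, shift `c(a − a')`. -/
theorem rowCorr_lam_unforced (c : ℤ) (B a a' : ℕ) (ha : 1 ≤ a)
    (hpos : ∀ b ∈ Icc 1 B, 1 ≤ (a : ℤ) * b + c ∧ 1 ≤ (a' : ℤ) * b + c) :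
    rowCorr lam c B a a' =
      lam a * ∑ b ∈ Icc 1 B, lam (Int.toNat ((a : ℤ) * b + c)) *
        lam (Int.toNat ((a' : ℤ) * ((a : ℤ) * b + c) + c * ((a : ℤ) - a'))) := by
  unfold rowCorr
  rw [mul_sum]
  refine sum_congr rfl fun b hb => ?_
  obtain ⟨_, h2⟩ := hpos b hb
  have halg : (a' : ℤ) * ((a : ℤ) * b + c) + c * ((a : ℤ) - a') = (a : ℤ) * ((a' : ℤ) * b + c) := by
    ring
  rw [halg, lam_toNat_mul (by linarith)]
  have hsq : lam a ^ 2 = 1 := lam_sq (by omega)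
  linear_combination (-(lam (Int.toNat ((a : ℤ) * b + c)) * lam (Int.toNat ((a' : ℤ) * b + c)))) * hsq

/-- The multiples of `d ≥ 1` in `[1, dB]` are exactly `d · [1, B]`. -/
theorem filter_dvd_Icc_eq_map {d : ℕ} (hd : d ≠ 0) (B : ℕ) :
    (Icc 1 (d * B)).filter (fun b' => d ∣ b') =
      (Icc 1 B).map ⟨fun b => d * b, mul_right_injective₀ hd⟩ := by
  ext x
  simp only [mem_filter, mem_Icc, mem_map, Function.Embedding.coeFn_mk]
  constructor
  · rintro ⟨⟨h1, h2⟩, k, rfl⟩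
    refine ⟨k, ⟨?_, ?_⟩, rfl⟩
    · rcases Nat.eq_zero_or_pos k with hk | hk
      · subst hk; simp at h1
      · exact hk
    · exact Nat.le_of_mul_le_mul_left h2 (Nat.pos_of_ne_zero hd)
  · rintro ⟨k, ⟨h1, h2⟩, rfl⟩
    refine ⟨⟨?_, Nat.mul_le_mul_left d h2⟩, dvd_mul_right d k⟩
    exact Nat.one_le_iff_ne_zero.mpr (Nat.mul_ne_zero hd (by omega))

/-- L2 (multiple identity, column form): for every `d ≥ 1` (in particular every prime) and table
entries `≥ 1`, `T_c(a,a';B) = Σ_{b'' ≤ dB, d ∣ b''} λ(a b'' + d c) λ(a' b'' + d c)`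
(since `λ(d(ab+c)) = λ(d)λ(ab+c)` twice and `λ(d)² = 1`): the `c`-table's row correlations are row
correlations of the `dc`-table restricted to the columns divisible by `d`. -/
theorem rowCorr_lam_multiple (c : ℤ) (B a a' d : ℕ) (hd : 1 ≤ d)
    (hpos : ∀ b ∈ Icc 1 B, 1 ≤ (a : ℤ) * b + c ∧ 1 ≤ (a' : ℤ) * b + c) :
    rowCorr lam c B a a' =
      ∑ b'' ∈ (Icc 1 (d * B)).filter (fun b'' => d ∣ b''),
        lam (Int.toNat ((a : ℤ) * b'' + d * c)) * lam (Int.toNat ((a' : ℤ) * b'' + d * c)) := by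
  rw [filter_dvd_Icc_eq_map (by omega) B, sum_map]
  unfold rowCorr
  refine sum_congr rfl fun b hb => ?_
  obtain ⟨h1, h2⟩ := hpos b hb
  simp only [Function.Embedding.coeFn_mk, Nat.cast_mul]
  have e1 : (a : ℤ) * ((d : ℤ) * b) + d * c = (d : ℤ) * ((a : ℤ) * b + c) := by ring
  have e2 : (a' : ℤ) * ((d : ℤ) * b) + d * c = (d : ℤ) * ((a' : ℤ) * b + c) := by ring
  rw [e1, e2, lam_toNat_mul (by linarith), lam_toNat_mul (by linarith)]
  have hsq : lam d ^ 2 = 1 := lam_sq (by omega)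
  linear_combination (-(lam (Int.toNat ((a : ℤ) * b + c)) * lam (Int.toNat ((a' : ℤ) * b + c)))) * hsq

/-- L9 (row anatomy descent): the bilinear form of the `(A,B)` table restricted to rows divisible by `d`
is a bilinear form of the `(A/d, dB)` table (same `x = AB`, same `c`) against the column vector spread to
the multiples of `d`:
`Σ_{a₁ ∈ (A/d, 2A/d]} Σ_{b ≤ B} u(d a₁) v(b) λ(d a₁ b + c) = Σ_{a₁} Σ_{b' ≤ dB, d ∣ b'} u(d a₁) v(b'/d) λ(a₁ b' + c)`. -/
theorem descent_rows_divisible (c : ℤ) (A B d : ℕ) (hd : 1 ≤ d) (u v : ℕ → ℝ) :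
    (∑ a₁ ∈ Ioc (A / d) (2 * A / d), ∑ b ∈ Icc 1 B,
        u (d * a₁) * v b * lam (Int.toNat ((d : ℤ) * a₁ * b + c))) =
      ∑ a₁ ∈ Ioc (A / d) (2 * A / d), ∑ b' ∈ (Icc 1 (d * B)).filter (fun b' => d ∣ b'),
        u (d * a₁) * v (b' / d) * lam (Int.toNat ((a₁ : ℤ) * b' + c)) := by
  refine sum_congr rfl fun a₁ _ => ?_
  rw [filter_dvd_Icc_eq_map (by omega) B, sum_map]
  refine sum_congr rfl fun b _ => ?_
  simp only [Function.Embedding.coeFn_mk, Nat.cast_mul]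
  rw [Nat.mul_div_cancel_left b (by omega)]
  congr 2
  ring

/-! ## Shift-multiple monotonicity of the crux -/

/-- `d · ⌊y⌋₊ ≤ ⌊d · y⌋₊` for `y ≥ 0`. -/
theorem natMul_floor_le {d : ℕ} {y : ℝ} (hy : 0 ≤ y) : d * ⌊y⌋₊ ≤ ⌊(d : ℝ) * y⌋₊ := by
  refine Nat.le_floor ?_
  push_cast
  exact mul_le_mul_of_nonneg_left (Nat.floor_le hy) (Nat.cast_nonneg d)

/-- POINTWISE DOMINATION (L2 + positivity): for `d ≥ 1`, `x ≥ 0` and `|c| + 1 ≤ A` (no `Int.toNat`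
truncation), the crux's moment at shift `c` and scale `(x, A)` is at most the moment at shift `dc` and
scale `(dx, A)`: `T_c(x,A) ≤ T_{dc}(dx,A)` — the `c`-table is the `{d ∣ column}` slice of the `dc`-table
with `d·⌊x/A⌋ ≤ ⌊dx/A⌋` columns, and block fourth moments are monotone in the column set. -/
theorem moment_le_moment_mul_shift (c : ℤ) {d : ℕ} (hd : 1 ≤ d) {x A : ℝ} (hx : 0 ≤ x)
    (hcA : (|c| : ℝ) + 1 ≤ A) :
    moment lam c x A ≤ moment lam ((d : ℤ) * c) ((d : ℝ) * x) A := by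
  have hA0 : 0 < A := by linarith [abs_nonneg (c : ℝ)]
  unfold moment momentN
  set A₁ := ⌊A⌋₊ with hA₁
  set A₂ := ⌊2 * A⌋₊
  set B := ⌊x / A⌋₊
  set m : ℕ → ℕ → ℝ := fun a b'' => lam (Int.toNat ((a : ℤ) * b'' + d * c)) with hm
  have hrow : ∀ a ∈ Ioc A₁ A₂, ∀ a' ∈ Ioc A₁ A₂, rowCorr lam c B a a' =
      ∑ b'' ∈ (Icc 1 (d * B)).filter (fun b'' => d ∣ b''), m a b'' * m a' b'' := by
    intro a ha a' ha'
    rw [rowCorr_lam_multiple c B a a' d hd fun b hb =>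
      ⟨one_le_arg_of_window hcA ha hb, one_le_arg_of_window hcA ha' hb⟩]
  have hVT : (Icc 1 (d * B)).filter (fun b'' => d ∣ b'') ⊆ Icc 1 ⌊(d : ℝ) * x / A⌋₊ := by
    intro b'' hb''
    rw [mem_filter, mem_Icc] at hb''
    rw [mem_Icc]
    refine ⟨hb''.1.1, hb''.1.2.trans ?_⟩
    rw [mul_div_assoc]
    exact natMul_floor_le (div_nonneg hx hA0.le)
  calc ∑ a ∈ Ioc A₁ A₂, ∑ a' ∈ Ioc A₁ A₂, rowCorr lam c B a a' ^ 2
      = ∑ a ∈ Ioc A₁ A₂, ∑ a' ∈ Ioc A₁ A₂,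
          (∑ b'' ∈ (Icc 1 (d * B)).filter (fun b'' => d ∣ b''), m a b'' * m a' b'') ^ 2 :=
        sum_congr rfl fun a ha => sum_congr rfl fun a' ha' => by rw [hrow a ha a' ha']
    _ ≤ ∑ a ∈ Ioc A₁ A₂, ∑ a' ∈ Ioc A₁ A₂,
          (∑ b'' ∈ Icc 1 ⌊(d : ℝ) * x / A⌋₊, m a b'' * m a' b'') ^ 2 :=
        tableToDilated_block_fourth_moment_le (subset_refl _) hVT m
    _ = ∑ a ∈ Ioc A₁ A₂, ∑ a' ∈ Ioc A₁ A₂, rowCorr lam ((d : ℤ) * c) ⌊(d : ℝ) * x / A⌋₊ a a' ^ 2 := by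
        rfl

/-- Eventually `M ≤ x ^ δ` (`δ > 0`). -/
theorem eventually_le_rpow {δ : ℝ} (hδ : 0 < δ) (M : ℝ) : ∃ X : ℝ, ∀ x : ℝ, X ≤ x → M ≤ x ^ δ := by
  have h := (tendsto_rpow_atTop hδ).eventually (Filter.eventually_ge_atTop M)
  rw [Filter.eventually_atTop] at h
  obtain ⟨X, hX⟩ := h
  exact ⟨X, fun x hx => hX x hx⟩

/-- The final numerical step: `(dx)²/(log(dx))^{C+1} ≤ x²/(log x)^C` once `d² ≤ log x` (`x > 0`, `d ≥ 1`). -/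
theorem mul_sq_div_log_rpow_le {d : ℕ} (hd : 1 ≤ d) {x C : ℝ} (hx : 0 < x) (hC : 0 ≤ C)
    (hd2 : (d : ℝ) ^ 2 ≤ Real.log x) :
    ((d : ℝ) * x) ^ 2 / Real.log ((d : ℝ) * x) ^ (C + 1) ≤ x ^ 2 / Real.log x ^ C := by
  have hd1 : (1 : ℝ) ≤ d := by exact_mod_cast hd
  have hL : 0 < Real.log x := lt_of_lt_of_le (by positivity) hd2
  have hdx : x ≤ (d : ℝ) * x := le_mul_of_one_le_left hx.le hd1
  have hLd : Real.log x ≤ Real.log ((d : ℝ) * x) := Real.log_le_log hx hdx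
  have h1 : Real.log x ^ (C + 1) ≤ Real.log ((d : ℝ) * x) ^ (C + 1) :=
    Real.rpow_le_rpow hL.le hLd (by linarith)
  have h2 : 0 < Real.log x ^ (C + 1) := Real.rpow_pos_of_pos hL _
  have hLC : 0 < Real.log x ^ C := Real.rpow_pos_of_pos hL _
  calc ((d : ℝ) * x) ^ 2 / Real.log ((d : ℝ) * x) ^ (C + 1)
      ≤ ((d : ℝ) * x) ^ 2 / Real.log x ^ (C + 1) := div_le_div_of_nonneg_left (sq_nonneg _) h2 h1
    _ = (x ^ 2 / Real.log x ^ C) * ((d : ℝ) ^ 2 / Real.log x) := by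
        rw [Real.rpow_add hL, Real.rpow_one, div_mul_div_comm]
        ring
    _ ≤ x ^ 2 / Real.log x ^ C :=
        mul_le_of_le_one_right (by positivity) ((div_le_one hL).mpr hd2)

/-- SHIFT-MULTIPLE MONOTONICITY of the crux: for every `d ≥ 1`, the crux's bound at shift `dc` (at all
parameter points `(δ, C)`) implies the bound at shift `c` (at all `(δ, C)`). Given `(δ, C)` at shift `c`,
use shift `dc` at `(δ, C+1)` on the part `A ≥ (dx)^δ` of the window and at `(δ/2, C+1)` on the part
`x^δ ≤ A < (dx)^δ`, both at scale `dx`; then `T_c(x,A) ≤ T_{dc}(dx,A) ≤ (dx)²/(log dx)^{C+1} ≤ x²/(log x)^C`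
once `log x ≥ d²`. -/
theorem tableChowlaBoundAt_of_mul_shift (c : ℤ) {d : ℕ} (hd : 1 ≤ d)
    (h : ∀ δ : ℝ, 0 < δ → δ ≤ 1 / 12 → ∀ C : ℝ, 0 < C → TableChowlaBoundAt lam ((d : ℤ) * c) δ C)
    {δ : ℝ} (hδ : 0 < δ) (hδ' : δ ≤ 1 / 12) {C : ℝ} (hC : 0 < C) :
    TableChowlaBoundAt lam c δ C := by
  obtain ⟨x₁, hx₁⟩ := h δ hδ hδ' (C + 1) (by linarith)
  obtain ⟨x₂, hx₂⟩ := h (δ / 2) (by linarith) (by linarith) (C + 1) (by linarith)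
  obtain ⟨X₃, hX₃⟩ := eventually_le_log_rpow (C := 1) one_pos ((d : ℝ) ^ 2)
  obtain ⟨X₄, hX₄⟩ := eventually_le_rpow hδ ((|c| : ℝ) + 1)
  have hd1 : (1 : ℝ) ≤ d := by exact_mod_cast hd
  refine ⟨max (max x₁ x₂) (max (max X₃ X₄) (max (d : ℝ) 1)), fun x hx A hA1 hA2 => ?_⟩
  simp only [max_le_iff] at hx
  obtain ⟨⟨hxx₁, hxx₂⟩, ⟨hxX₃, hxX₄⟩, hxd, hx1⟩ := hx
  have hx0 : 0 < x := by linarith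
  have hdx : x ≤ (d : ℝ) * x := le_mul_of_one_le_left hx0.le hd1
  have hdx1 : (1 : ℝ) ≤ (d : ℝ) * x := hx1.trans hdx
  have hcA : (|c| : ℝ) + 1 ≤ A := (hX₄ x hxX₄).trans hA1
  have hd2 : (d : ℝ) ^ 2 ≤ Real.log x := by
    have := hX₃ x hxX₃
    rwa [Real.rpow_one] at this
  have hmono := moment_le_moment_mul_shift c hd hx0.le hcA
  have hfin := mul_sq_div_log_rpow_le hd hx0 hC.le hd2
  -- the bound at shift `dc`, scale `dx`
  have hbound : moment lam ((d : ℤ) * c) ((d : ℝ) * x) A ≤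
      ((d : ℝ) * x) ^ 2 / Real.log ((d : ℝ) * x) ^ (C + 1) := by
    by_cases hcase : ((d : ℝ) * x) ^ δ ≤ A
    · refine hx₁ _ (hxx₁.trans hdx) A hcase (hA2.trans ?_)
      exact Real.rpow_le_rpow hx0.le hdx (by linarith)
    · rw [not_le] at hcase
      refine hx₂ _ (hxx₂.trans hdx) A ?_ ?_
      · -- `(dx)^(δ/2) ≤ x^δ ≤ A` since `d ≤ x`
        refine le_trans ?_ hA1
        have hdxx : (d : ℝ) * x ≤ x ^ (2 : ℝ) := by
          rw [Real.rpow_two, sq]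
          exact mul_le_mul_of_nonneg_right hxd hx0.le
        calc ((d : ℝ) * x) ^ (δ / 2) ≤ (x ^ (2 : ℝ)) ^ (δ / 2) :=
              Real.rpow_le_rpow (by positivity) hdxx (by linarith)
          _ = x ^ δ := by rw [← Real.rpow_mul hx0.le]; ring_nf
      · refine hcase.le.trans ?_
        exact Real.rpow_le_rpow_of_exponent_le hdx1 (by linarith)
  exact hmono.trans (hbound.trans hfin)

/-- For every `D ≥ 1`, the crux `TableChowla` is EQUIVALENT to its restriction to the shifts divisible
by `D`: without loss of generality the shift is divisible by any fixed modulus. -/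
theorem tableChowla_iff_shifts_dvd {D : ℕ} (hD : 1 ≤ D) :
    LiouvilleShiftedTables.TableChowla ↔
      ∀ c : ℤ, c ≠ 0 → (D : ℤ) ∣ c → ∀ δ : ℝ, 0 < δ → δ ≤ 1 / 12 → ∀ C : ℝ, 0 < C →
        TableChowlaBoundAt lam c δ C := by
  rw [tableChowla_iff_boundAt]
  constructor
  · exact fun h c hc _ => h c hc
  · intro h c hc δ hδ hδ' C hC
    have hD0 : (D : ℤ) ≠ 0 := by exact_mod_cast (by omega : D ≠ 0)
    exact tableChowlaBoundAt_of_mul_shift c hD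
      (fun δ hδ hδ' C hC => h ((D : ℤ) * c) (mul_ne_zero hD0 hc) (dvd_mul_right _ _) δ hδ hδ' C hC)
      hδ hδ' hC

/-- REGISTERED SUB-GOAL (stub `tableChowla_shiftsDvd` of stmt-Parity-14270, closed form of
`tableChowla_iff_shifts_dvd`): for every `D ≥ 1`, the crux `TableChowla` is equivalent to its
restriction to the shifts divisible by `D`. -/
theorem tableChowla_shiftsDvd : ∀ D : ℕ, 1 ≤ D → (Summit.Parity.GeneralizedHardyLittlewood.Theses.LiouvilleShiftedTables.TableChowla ↔ ∀ c : ℤ, c ≠ 0 → (D : ℤ) ∣ c → ∀ δ : ℝ, 0 < δ → δ ≤ 1 / 12 → ∀ C : ℝ, 0 < C → Summit.Parity.GeneralizedHardyLittlewood.Theorems.TableChowla.Negative.TableChowlaBoundAt Summit.Parity.GeneralizedHardyLittlewood.Theorems.TableChowla.Negative.lam c δ C) :=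
  fun _ hD => tableChowla_iff_shifts_dvd hD

end

end Summit.Parity.GeneralizedHardyLittlewood.Theorems.TableChowla.SketchIdentities
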